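import Mathlib
import Summits.Langlands.Langlands.Theses.PhantomRMYoshida
import Literature.NumberTheory.Automorphic.ReciprocityGLn
import Literature.NumberTheory.Automorphic.AutomorphicRepsGL
import Literature.NumberTheory.Automorphic.GLnAdelicStructure
import Literature.NumberTheory.GaloisRepresentations.ModPGaloisRep
import Literature.NumberTheory.GaloisRepresentations.GaloisRep
import Literature.NumberTheory.GaloisRepresentations.SymplecticMultiplier
import Literature.NumberTheory.GaloisRepresentations.LocalGaloisGroup
import Literature.NumberTheory.DiophantineGeometry.WeilPairingRationalTateModule
import Literature.NumberTheory.GaloisRepresentations.SerreWeight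
import Literature.NumberTheory.GaloisRepresentations.ResidualPair
import Literature.NumberTheory.GaloisRepresentations.ResidualPairIntegrality
import Literature.NumberTheory.GaloisRepresentations.FramedRepBaseChange
import Literature.NumberTheory.GaloisRepresentations.ArtinRestriction
import Literature.NumberTheory.Automorphic.AdicCompletionLocalField
import Literature.NumberTheory.Automorphic.GLnAdelicStructureProofs
import Literature.NumberTheory.DiophantineGeometry.AVGaloisModule
import Literature.NumberTheory.DiophantineGeometry.AVGaloisModuleContinuityProofs
import Literature.NumberTheory.DiophantineGeometry.AVGaloisModuleTateRankOfCubeProofs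
import Literature.NumberTheory.DiophantineGeometry.AbelianVarietyOrdinaryReduction
import Literature.FieldTheory.AlgClosed.PadicAlgClEquivComplex
import Summits.Langlands.Langlands.Theorems.PhantomRMYoshidaStableYoshidaCongruenceFramedH1
import HarnessLib
import Literature.NumberTheory.DiophantineGeometry.BcgpSwitchExistsModularAbelianSurface

/-!
# Stub `stub_switchToModularSurface` (line `level-three-weierstrass-switch`, crux stmt-Langlands-13640)

The `2`–`3` switch of Boxer–Calegari–Gee–Pilloni (arXiv:2502.20645, Lemma 9.4.2 with the 2-adic
ordinary modularity Theorem 8.3.2 and the `GSp₄ → GL₄` transfer, exactly as combined in the proof of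
their Thm. 9.5.2) lands on a MODULAR abelian surface `B/ℚ`.  This file states that published fact INLINE
over tree vocabulary (`bcgp_switch_exists_modular_abelianSurface`; the Weil-pairing fact
`weilPairing_rationalTateModule` and the framed `H¹` `framedH1` live in the imported support file
`PhantomRMYoshidaStableYoshidaCongruenceFramedH1.lean`) and proves the REGISTERED stub signature
`stub_switchToModularSurface` (reshape v4 of the checked skeleton: the two facts are its first two
hypotheses).  The line vocabulary (`epsBar`, `toK`, `IsModelOf`, `IsOrdinaryFlatAt`, `IsSwitchableAtTwo`,
`Switchable`, `TateFrame`, `EndTrivial`) is copied VERBATIM from the checked skeleton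
(`Cruxes/StableYoshidaCongruence/Lines/level_three_weierstrass_switch.lean`) so that the statement
elaborates identically to its registration.  Worker of lead prover-line-stmt-Langlands-13640-0 (2026-08-16).
-/

set_option linter.dupNamespace false

noncomputable section

open CategoryTheory IsDedekindDomain
open scoped NumberField Matrix
open Literature.NumberTheory.GaloisRepresentations Literature.NumberTheory.Automorphic
open Literature.AlgebraicGeometry.Motives (AbelianVariety)
open Literature.NumberTheory.DiophantineGeometry (weilPairing_rationalTateModule)

namespace Summit.Langlands.Langlands.Cruxes.StableYoshidaCongruence.LevelThreeWeierstrassSwitch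

/-! ## Vocabulary I (only `epsBar`) — verbatim from the skeleton -/

section Names

variable (p : ℕ) [Fact p.Prime] (k : Type) [Field k] [CharP k p] [TopologicalSpace k]
  [DiscreteTopology k]

/-- `ε̄ : Γ_ℚ → (ℤ/p)ˣ`, the mod-`p` cyclotomic character exactly as spelled in the route file. -/
def epsBar : Field.absoluteGaloisGroup ℚ →* (ZMod p)ˣ :=
  (modularCyclotomicCharacter (AlgebraicClosure ℚ)
      (HasEnoughRootsOfUnity.natCard_rootsOfUnity (AlgebraicClosure ℚ) p)).comp
    (MulSemiringAction.toRingAut (Field.absoluteGaloisGroup ℚ) (AlgebraicClosure ℚ))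

end Names

/-! ## Vocabulary II — the sector: switchable `GSp₄(𝔽_p)`-models (BCGP2025 Lemma 9.4.2 hypotheses) -/

section Sector

variable (p : ℕ) [Fact p.Prime] (k : Type) [Field k] [CharP k p] [TopologicalSpace k]
  [DiscreteTopology k]

/-- Extension of scalars `𝔽_p → k` of an `𝔽_p`-valued framed representation (same spelling as the
route's `PhantomRMTransport`). -/
def toK (ρb : FramedGaloisRep ℚ (ZMod p) 4) : FramedGaloisRep ℚ k 4 :=
  FramedRep.baseChange (ZMod.castHom (dvd_refl p) k) continuous_of_discreteTopology ρb

variable {p k}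

/-- `IsModelOf ρb σ σ'`: `ρb ⊗_{𝔽_p} k` is `GL₄(k)`-conjugate to the block-diagonal `σ ⊕ σ'` (verbatim the
skeleton's definition). -/
def IsModelOf (ρb : FramedGaloisRep ℚ (ZMod p) 4) (σ σ' : FramedGaloisRep ℚ k 2) : Prop :=
  ∃ h : GL (Fin 4) k, ∀ x,
    (h⁻¹ * toK p k ρb x * h).val =
      Matrix.reindex finSumFinEquiv finSumFinEquiv (Matrix.fromBlocks (σ x).val 0 0 (σ' x).val)

variable (p) in
/-- `IsOrdinaryFlatAt v ρb` (`v ∣ p`): `ρb|_{Γ_{ℚ_v}}` is (i) ORDINARY WITH UNRAMIFIED SUB — block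
upper-triangular in some `𝔽_p`-frame with inertia trivial on the first `2 × 2` block and the scalar `ε̄⁻¹`
on the second ("`ρb^∨|_{Γ_{ℚ_p}}` ordinary", BCGP Cor. 9.3.5) — and (ii) PEU RAMIFIÉE (tree
`ModPGaloisRep.IsPeuRamifie`), which for this shape and `p` odd is "`ρb^∨|_{Γ_{ℚ_p}}` finite flat"
(Serre 1987 §2.4/§2.8): together exactly the hypothesis at `3` of arXiv:2502.20645 Lemma 9.4.2.  Verbatim
the skeleton's definition. -/
def IsOrdinaryFlatAt (v : HeightOneSpectrum (𝓞 ℚ)) (ρb : FramedGaloisRep ℚ (ZMod p) 4) : Prop :=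
  ModPGaloisRep.IsPeuRamifie (ρb.toLocal v) ∧
  ∃ g : GL (Fin 4) (ZMod p),
    (∀ (τ : Field.absoluteGaloisGroup (v.adicCompletion ℚ)) (i j : Fin 4), 2 ≤ (i : ℕ) → (j : ℕ) < 2 →
        (g * ρb.toLocal v τ * g⁻¹).val i j = 0) ∧
    (∀ τ ∈ absInertia (v.adicCompletion ℚ), ∀ i j : Fin 4, (i : ℕ) < 2 → (j : ℕ) < 2 →
        (g * ρb.toLocal v τ * g⁻¹).val i j = if i = j then 1 else 0) ∧
    (∀ τ ∈ absInertia (v.adicCompletion ℚ), ∀ i j : Fin 4, 2 ≤ (i : ℕ) → 2 ≤ (j : ℕ) →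
        (g * ρb.toLocal v τ * g⁻¹).val i j =
          if i = j then (((epsBar p (absGaloisRestrict ℚ (v.adicCompletion ℚ) τ))⁻¹ : (ZMod p)ˣ) : ZMod p)
          else 0)

variable (p) in
/-- `IsSwitchableAtTwo v ρb` (`v ∣ 2`): `ρb` is unramified at `2` and `charpoly ρb(Frob₂) ≠ (X² ± X + 2)²`
(arXiv:2502.20645 Thm 9.5.2 (2) ⟺ `Frob₂ ∉ 4C ∪ 12C`).  Verbatim the skeleton's definition. -/
def IsSwitchableAtTwo (v : HeightOneSpectrum (𝓞 ℚ)) (ρb : FramedGaloisRep ℚ (ZMod p) 4) : Prop :=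
  ρb.IsUnramifiedAt v ∧
    ∀ Q : Polynomial (ZMod p), ρb.HasFrobCharpolyAt v Q →
      Q ≠ (Polynomial.X ^ 2 + Polynomial.X + 2) ^ 2 ∧ Q ≠ (Polynomial.X ^ 2 - Polynomial.X + 2) ^ 2

variable (p k) in
/-- **`Switchable p k σ σ'`** — the SECTOR hypothesis of the line (meaningful for every `p`, used at
`p = 3`): `σ ⊕ σ'` admits an `𝔽_p`-model `ρb : Γ_ℚ → GL₄(𝔽_p)` which is symplectic with multiplier
`ε̄⁻¹` (tree `IsSymplecticWithMultiplierFun`), ordinary-with-unramified-sub and peu ramifié at the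
place(s) above `p`, and unramified at `2` with `charpoly ρb(Frob₂) ≠ (X² ± X + 2)²` — verbatim the
hypotheses of arXiv:2502.20645 Lemma 9.4.2 ("switching") for `p = 3`. -/
def Switchable (σ σ' : FramedGaloisRep ℚ k 2) : Prop :=
  ∃ ρb : FramedGaloisRep ℚ (ZMod p) 4,
    ρb.IsSymplecticWithMultiplierFun (fun g => (((epsBar p g)⁻¹ : (ZMod p)ˣ) : ZMod p)) ∧
    IsModelOf ρb σ σ' ∧
    (∀ v : HeightOneSpectrum (𝓞 ℚ), ((p : ℕ) : 𝓞 ℚ) ∈ v.asIdeal → IsOrdinaryFlatAt p v ρb) ∧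
    (∀ v : HeightOneSpectrum (𝓞 ℚ), ((2 : ℕ) : 𝓞 ℚ) ∈ v.asIdeal → IsSwitchableAtTwo p v ρb)

end Sector

/-! ## Vocabulary III — abelian surfaces over `ℚ` and their framed `p`-adic `H¹` -/

section Surfaces

variable (p : ℕ) [Fact p.Prime]

/-- `TateFrame p B b ρ₀`: `ρ₀` IS the contragredient of `V_p(B) ⊗ ℚ̄_p` in the dual basis of the
`ℚ_p`-basis `b` of `V_p(B)` (matrix of `g` on the dual = transpose of the matrix of `g⁻¹`), i.e.
`ρ₀ ≅ H¹_ét(B_ℚ̄, ℚ̄_p)`, BCGP's `ρ_{B,p}` (cohomological convention).  Verbatim the skeleton's definition. -/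
def TateFrame (B : AbelianVariety ℚ) (b : Module.Basis (Fin 4) ℚ_[p] (B.rationalTateModule p))
    (ρ₀ : FramedGaloisRep ℚ (PadicAlgCl p) 4) : Prop :=
  ∀ g : Field.absoluteGaloisGroup ℚ,
    (ρ₀ g).val =
      ((LinearMap.toMatrix b b (B.rationalTateRep p g⁻¹)).map (algebraMap ℚ_[p] (PadicAlgCl p))).transpose

/-- `EndTrivial B`: every endomorphism of `B` defined over `ℚ` is multiplication by an integer
(`End_ℚ(B) = ℤ`; implied by BCGP's `End(B_ℚ̄) = ℤ`, and all that Faltings needs for absolute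
irreducibility of `V_p(B)`). -/
def EndTrivial (B : AbelianVariety ℚ) : Prop :=
  ∀ f : B ⟶ B, ∃ n : ℤ, f = n • 𝟙 B

end Surfaces

/-! ## The published fact (stated inline over tree vocabulary; the gate relocates it) -/

section Facts

end Facts

/-! ## Dictionary lemmas, vocabulary half -/

section Dictionary

/-! ### The model `ρb ⊗ k ∼ σ ⊕ σ'`: characteristic polynomials and ramification -/

section Model

variable {p : ℕ} [Fact p.Prime] {k : Type} [Field k] [CharP k p] [TopologicalSpace k]
  [DiscreteTopology k]

omit [DiscreteTopology k] in
/-- If `ρb ⊗ k` is conjugate to `σ ⊕ σ'` then `det(X - ρb(g)) ⊗ k = det(X - σ(g)) det(X - σ'(g))`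
(conjugation invariance, `Matrix.charpoly_fromBlocks_zero₁₂`). -/
theorem IsModelOf.charpoly_map {ρb : FramedGaloisRep ℚ (ZMod p) 4} {σ σ' : FramedGaloisRep ℚ k 2}
    (h : IsModelOf ρb σ σ') (g : Field.absoluteGaloisGroup ℚ) :
    (FramedRep.charpoly ρb g).map (ZMod.castHom (dvd_refl p) k) =
      FramedRep.charpoly σ g * FramedRep.charpoly σ' g := by
  obtain ⟨h, hh⟩ := h
  have h1 : FramedRep.charpoly (toK p k ρb) g =
      (FramedRep.charpoly ρb g).map (ZMod.castHom (dvd_refl p) k) :=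
    FramedRep.charpoly_baseChange _ _ ρb g
  rw [← h1]
  have h2 : FramedRep.charpoly (toK p k ρb) g =
      ((h⁻¹ * toK p k ρb g * h).val).charpoly := by
    unfold FramedRep.charpoly
    rw [Units.val_mul, Units.val_mul, Matrix.coe_units_inv, Matrix.charpoly_units_conj']
  rw [h2, hh g, Matrix.charpoly_reindex, Matrix.charpoly_fromBlocks_zero₁₂]
  rfl

omit [Fact p.Prime] [DiscreteTopology k] in
/-- If `ρb ⊗ k` is conjugate to `σ ⊕ σ'` and `ρb(τ) = 1` then `σ(τ) = 1` and `σ'(τ) = 1`. -/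
theorem IsModelOf.apply_eq_one {ρb : FramedGaloisRep ℚ (ZMod p) 4} {σ σ' : FramedGaloisRep ℚ k 2}
    (h : IsModelOf ρb σ σ') {τ : Field.absoluteGaloisGroup ℚ} (hτ : ρb τ = 1) :
    σ τ = 1 ∧ σ' τ = 1 := by
  obtain ⟨h, hh⟩ := h
  have h1 : toK p k ρb τ = 1 := by
    rw [toK, FramedRep.baseChange_apply, hτ, map_one]
  have h2 := hh τ
  rw [h1, mul_one, inv_mul_cancel, Units.val_one] at h2
  have hre1 : Matrix.reindex finSumFinEquiv finSumFinEquiv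
      (1 : Matrix (Fin 2 ⊕ Fin 2) (Fin 2 ⊕ Fin 2) k) = (1 : Matrix (Fin 4) (Fin 4) k) := by
    rw [Matrix.reindex_apply, Matrix.submatrix_one_equiv]
  have h3 : Matrix.fromBlocks (σ τ).val 0 0 (σ' τ).val = 1 :=
    (Matrix.reindex finSumFinEquiv finSumFinEquiv).injective (h2.symm.trans hre1.symm)
  rw [← Matrix.fromBlocks_one, Matrix.fromBlocks_inj] at h3
  exact ⟨Units.val_eq_one.1 h3.1, Units.val_eq_one.1 h3.2.2.2⟩

omit [Fact p.Prime] [DiscreteTopology k] in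
/-- Unramifiedness passes from the model `ρb` to the constituents `σ`, `σ'`. -/
theorem IsModelOf.isUnramifiedAt {ρb : FramedGaloisRep ℚ (ZMod p) 4} {σ σ' : FramedGaloisRep ℚ k 2}
    (h : IsModelOf ρb σ σ') {v : HeightOneSpectrum (𝓞 ℚ)} (hv : ρb.IsUnramifiedAt v) :
    σ.IsUnramifiedAt v ∧ σ'.IsUnramifiedAt v :=
  ⟨fun 𝔓 h𝔓 τ hτ => (h.apply_eq_one (hv 𝔓 h𝔓 τ hτ)).1,
    fun 𝔓 h𝔓 τ hτ => (h.apply_eq_one (hv 𝔓 h𝔓 τ hτ)).2⟩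

/-- A mod-`p` representation `Γ_ℚ → GL₄(𝔽_p)` (finite image) is unramified almost everywhere. -/
theorem eventually_isUnramifiedAt_zmod (ρb : FramedGaloisRep ℚ (ZMod p) 4) :
    ∀ᶠ v : HeightOneSpectrum (𝓞 ℚ) in Filter.cofinite, ρb.IsUnramifiedAt v :=
  ρb.eventually_isUnramifiedAt_of_isOpen_ker (isOpen_ker_of_finite_range ρb)

end Model

section H1b

variable (p : ℕ) [Fact p.Prime]

/-- `framedH1` satisfies the line's `TateFrame`. -/
theorem tateFrame_framedH1 (B : AbelianVariety ℚ)
    (b : Module.Basis (Fin 4) ℚ_[p] (B.rationalTateModule p)) : TateFrame p B b (framedH1 p B b) :=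
  fun g => framedH1_apply_val p B b g

end H1b

/-! ### The residual pair of the framed `H¹` -/

section Residual

variable {k : Type} [Field k] [CharP k 3] [TopologicalSpace k] [DiscreteTopology k]

/-- **`ρ̄_{B,3}^{ss} ≅ σ ⊕ σ'` for the framed `H¹`.**  If every `det(X - r(g))` has a `ℤ₃`-lift
reducing mod `3` to `det(X - ρb(g))` (conclusion "`ρ̄_{B,3} ≅ ρb`" of the switching fact), `ρb ⊗ k` is
conjugate to `σ ⊕ σ'` (`IsModelOf`) and `r` is unramified almost everywhere, then
`r.HasResidualPair red σ σ'`: at the almost all `v` where `r` and `ρb` (finite image) are unramified,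
take any arithmetic Frobenius `g` at any `𝔓 ∣ v` (`hasResidualPair_of_frobenius`). -/
theorem hasResidualPair_of_congruence (red : Valued.integer (PadicAlgCl 3) →+* k)
    {ρb : FramedGaloisRep ℚ (ZMod 3) 4} {σ σ' : FramedGaloisRep ℚ k 2} (hmodel : IsModelOf ρb σ σ')
    {r : FramedGaloisRep ℚ (PadicAlgCl 3) 4}
    (hcong : ∀ g : Field.absoluteGaloisGroup ℚ, ∃ P : Polynomial ℤ_[3],
        P.map (algebraMap ℤ_[3] (PadicAlgCl 3)) = FramedRep.charpoly r g ∧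
        P.map (PadicInt.toZMod (p := 3)) = FramedRep.charpoly ρb g)
    (hunr : ∀ᶠ v : HeightOneSpectrum (𝓞 ℚ) in Filter.cofinite, r.IsUnramifiedAt v) :
    r.HasResidualPair red σ σ' := by
  have hfin : {v : HeightOneSpectrum (𝓞 ℚ) | ¬ (r.IsUnramifiedAt v ∧ ρb.IsUnramifiedAt v)}.Finite :=
    Filter.eventually_cofinite.1 (hunr.and (eventually_isUnramifiedAt_zmod ρb))
  refine FramedGaloisRep.hasResidualPair_of_frobenius hfin fun v hv => ?_
  simp only [Set.mem_setOf_eq, not_not] at hv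
  obtain ⟨hrv, hρbv⟩ := hv
  obtain ⟨hσv, hσ'v⟩ := hmodel.isUnramifiedAt hρbv
  obtain ⟨𝔓, h𝔓⟩ := v.primesAbove_nonempty
  obtain ⟨g, hg⟩ := HeightOneSpectrum.exists_isArithFrobAt_of_mem_primesAbove_holds h𝔓
  obtain ⟨P, hP, hPred⟩ := hcong g
  obtain ⟨P', hP'1, hP'2⟩ := exists_integer_polynomial_of_padicInt red P
  refine ⟨hrv, hσv, hσ'v, 𝔓, h𝔓, g, hg, P', ?_, ?_⟩
  · rw [hP'1, hP]
  · rw [hP'2, hPred, hmodel.charpoly_map]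

end Residual

end Dictionary

/-! ## The stub, conditionally on the two published facts -/

/-- **Stub 2 (`stub_switchToModularSurface`) — the registered signature (reshape v4: the two published
facts are its first two hypotheses).**  Dictionary: `B` from the switching fact (its three hypotheses are VERBATIM
the three local clauses of `Switchable 3 k σ σ'`, `epsBar` being definitionally `modPCyclotomicCharacterZMod ℚ`);
`b` a `ℚ₃`-basis of `V₃ B` (`finrank_rationalTateModule_eq_holds`); `ρ₀ := framedH1 3 B b` (`TateFrame` by
construction); symplecticity from the Weil pairing (`isSymplectic_framedH1`); `HasResidualPair` from
`ρ̄_{B,3} ≅ ρb` + `IsModelOf` (`hasResidualPair_of_congruence`), a.e. unramifiedness read off automorphy.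
[cite: BoxerCalegariGeePilloni2025, Lemma 9.4.2, Thm. 8.3.2, Thm. 9.5.2 (arXiv:2502.20645)] -/
theorem stub_switchToModularSurface :
    Literature.NumberTheory.DiophantineGeometry.bcgp_switch_exists_modular_abelianSurface → weilPairing_rationalTateModule →
    ∀ (p : ℕ) [Fact p.Prime], p = 3 → ∀ (k : Type) [Field k] [CharP k p] [IsAlgClosed k]
      [TopologicalSpace k] [DiscreteTopology k] (red : Valued.integer (PadicAlgCl p) →+* k)
      (σ σ' : FramedGaloisRep ℚ k 2),
      Switchable p k σ σ' →
      ∃ (B : AbelianVariety ℚ) (b : Module.Basis (Fin 4) ℚ_[p] (B.rationalTateModule p))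
        (ρ₀ : FramedGaloisRep ℚ (PadicAlgCl p) 4),
        TateFrame p B b ρ₀ ∧ B.dim = 2 ∧
        (∀ v : HeightOneSpectrum (𝓞 ℚ), ((p : ℕ) : 𝓞 ℚ) ∈ v.asIdeal → B.HasGoodOrdinaryReductionAt v) ∧
        EndTrivial B ∧
        ρ₀.IsSymplecticWithMultiplierFun (fun g => algebraMap ℚ_[p] (PadicAlgCl p)
          ((((GaloisRep.cyclotomicCharacter ℚ p g)⁻¹ : ℤ_[p]ˣ) : ℤ_[p]) : ℚ_[p])) ∧
        ρ₀.HasResidualPair red σ σ' ∧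
        ∀ (hcpt : isCompact_glFiniteIntegralLevel 4 ℚ) (ι : PadicAlgCl p ≃+* ℂ),
          ∃ π : CuspidalAutomorphicRepData 4 ℚ hcpt, π.1.IsLAlgebraic ∧
            ∀ᶠ v : HeightOneSpectrum (𝓞 ℚ) in Filter.cofinite,
              ∃ a : Multiset ℂ, π.1.HasSatakeParamAt v a ∧ ρ₀.IsUnramifiedAt v ∧
                ρ₀.HasFrobCharpolyAt v (arithFrobPolyOfSatake ι v.residueCard 1 a) := by
  intro hBCGP hWeil p _ hp k _ _ _ _ _ red σ σ' hsw
  subst hp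
  obtain ⟨ρb, hsymp, hmodel, hord, htwo⟩ := hsw
  obtain ⟨B, hdim, hgood, hEnd, hH1⟩ := hBCGP ρb hsymp hord htwo
  have hrank : Module.finrank ℚ_[3] (B.rationalTateModule 3) = 4 := by
    rw [B.finrank_rationalTateModule_eq_holds 3 (natCast_prime_ne_zero_rat 3), hdim]
  haveI : Module.Finite ℚ_[3] (B.rationalTateModule 3) :=
    Module.finite_of_finrank_pos (by rw [hrank]; norm_num)
  let b : Module.Basis (Fin 4) ℚ_[3] (B.rationalTateModule 3) :=
    Module.finBasisOfFinrankEq ℚ_[3] _ hrank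
  obtain ⟨hcong, hAut⟩ := hH1 b (framedH1 3 B b) (tateFrame_framedH1 3 B b)
  have hunr : ∀ᶠ v : HeightOneSpectrum (𝓞 ℚ) in Filter.cofinite, (framedH1 3 B b).IsUnramifiedAt v := by
    obtain ⟨ι⟩ := PadicAlgCl.nonempty_ringEquiv_complex 3
    obtain ⟨π, -, hπ⟩ := hAut (isCompact_glFiniteIntegralLevel_holds 4 ℚ) ι
    exact hπ.mono fun v ⟨a, _, h, _⟩ => h
  exact ⟨B, b, framedH1 3 B b, tateFrame_framedH1 3 B b, hdim, hgood, hEnd,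
    isSymplectic_framedH1 3 hWeil B b, hasResidualPair_of_congruence red hmodel hcong hunr, hAut⟩

end Summit.Langlands.Langlands.Cruxes.StableYoshidaCongruence.LevelThreeWeierstrassSwitch
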